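/-
Copyright (c) 2026 The H21 project. Released under Apache 2.0 license.
-/
import Summits.RiemannHypothesis.RiemannHypothesis.Theorems.PfPersistenceGalerkinThreshold
import Summits.RiemannHypothesis.RiemannHypothesis.Theorems.PfPersistenceM2IndexSupremum
import HarnessLib

/-!
# `P_F` persistence — GAL-4 readings: the Galerkin negative index AS A NUMBER; `sup = #𝒬` (cand-3, gen 11)

Mechanism / rigidity campaign of the `pub-rhpf` cell (variational seat M2 = cand-3); NO claim about RH is made
anywhere in this file.  Everything here is RH-free and sorry-free; no numerical datum is used (all PROVED).

`galerkinNegIndex d win := sup {n | GalerkinNegIndexAtLeast d n win} ∈ ℕ∞` — the number of independent negative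
directions of the window matrix `d win` along the Galerkin ladder.  For the even block of `ζ` (`zetaDatum`) and
`𝒬 = {ρ : ζ(ρ) = 0, Re ρ > 1/2, Im ρ > 0}`:

* `natCast_le_galerkinNegIndex_iff` : `n ≤ galerkinNegIndex d win ↔ GalerkinNegIndexAtLeast d n win`;
  `galerkinNegIndex_eq_zero_iff` : `= 0 ↔ WindowPositive (d win)`.
* `galerkinNegIndex_le_encard` : NO truncated window matrix of `ζ` has more negative directions than there are
  off-line zero quadruples (unconditional, every window).
* **`iSup_galerkinNegIndex_eq_encard` : `⨆_{(a,N)} ind⁻(A^{(N)}(a)) = 𝒬.encard`** — the supremum over ALL windows of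
  the negative index of the truncated even block of `ζ` IS the number of off-line quadruples (in `ℕ ∪ {⊤}`;
  unconditional, RH-free; the Galerkin form of m2's `iSup_evenNegIndex_eq_encard`).
* `iSup_galerkinNegIndex_eq_evenNegIndex` : at fixed half-length `a`, `⨆_N ind⁻(A^{(N)}(a)) = ind⁻_ev(a)` (m2's
  continuum window index), attained as a monotone limit in `N` (`tendsto_galerkinNegIndex_atTop`); and
  `⨆_N ind⁻(A^{(N)}(a)) → 𝒬.encard` as `a → ∞` (`tendsto_iSup_galerkinNegIndex_atTop`).
* RH-EQUIVALENCE readings (labels only, no RH claim): `RH ↔ ∀ win, ind⁻ = 0 ↔ ⨆ ind⁻ = 0`.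
-/

set_option linter.dupNamespace false

noncomputable section

open Complex Filter Set MeasureTheory Topology Matrix Finset
open scoped Real ComplexConjugate

namespace Summit.RiemannHypothesis.RiemannHypothesis.Theorems.PfPersistence

open Literature.NumberTheory.LFunctions Literature.NumberTheory.LFunctions.WeilContinuous
open Literature.NumberTheory.LFunctions.ZetaZeros
open Summit.RiemannHypothesis.RiemannHypothesis.Theorems.PfPersistenceM2NegIndex
open Summit.RiemannHypothesis.RiemannHypothesis.Theorems.PfPersistenceParityIndex
  (riemannHypothesis_iff_quadrant_eq_empty)

/-! ## §1 The index number of a window matrix -/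

/-- the GALERKIN NEGATIVE INDEX NUMBER of the window matrix `d win`: `sup {n | GalerkinNegIndexAtLeast d n win}`
in `ℕ∞`. [folklore] -/
def galerkinNegIndex (d : Datum) (win : Window) : ℕ∞ :=
  ⨆ n : ℕ, ⨆ _ : GalerkinNegIndexAtLeast d n win, (n : ℕ∞)

/-- PROVED: the index notion is downward closed in `n`. [folklore] -/
theorem GalerkinNegIndexAtLeast.of_le {d : Datum} {m n : ℕ} {win : Window} (hmn : m ≤ n) :
    GalerkinNegIndexAtLeast d n win → GalerkinNegIndexAtLeast d m win := by
  induction n, hmn using Nat.le_induction with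
  | base => exact id
  | succ k _ ih => exact fun h ↦ ih h.of_succ

/-- PROVED: a negative `n`-space bounds the index number from below. [folklore] -/
theorem le_galerkinNegIndex_of {d : Datum} {n : ℕ} {win : Window} (h : GalerkinNegIndexAtLeast d n win) :
    (n : ℕ∞) ≤ galerkinNegIndex d win :=
  le_iSup_of_le (f := fun n : ℕ ↦ ⨆ _ : GalerkinNegIndexAtLeast d n win, (n : ℕ∞)) n
    (le_iSup (fun _ : GalerkinNegIndexAtLeast d n win ↦ (n : ℕ∞)) h)

/-- **PROVED: `n ≤ ind⁻(d win) ↔ GalerkinNegIndexAtLeast d n win`.** [folklore] -/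
theorem natCast_le_galerkinNegIndex_iff {d : Datum} {n : ℕ} {win : Window} :
    (n : ℕ∞) ≤ galerkinNegIndex d win ↔ GalerkinNegIndexAtLeast d n win := by
  refine ⟨fun h ↦ ?_, le_galerkinNegIndex_of⟩
  by_contra hn
  rcases Nat.eq_zero_or_pos n with h0 | hpos
  · exact hn (h0 ▸ galerkinNegIndexAtLeast_zero d win)
  · have hle : galerkinNegIndex d win ≤ ((n - 1 : ℕ) : ℕ∞) :=
      iSup_le fun m ↦ iSup_le fun hm ↦ by
        have hm' : m ≤ n - 1 := by
          by_contra h'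
          exact hn (hm.of_le (by omega))
        exact_mod_cast hm'
    have h2 : n ≤ n - 1 := by exact_mod_cast h.trans hle
    omega

/-- PROVED: `ind⁻(d win) = 0` iff the window matrix is positive semidefinite. [folklore] -/
theorem galerkinNegIndex_eq_zero_iff (d : Datum) (win : Window) :
    galerkinNegIndex d win = 0 ↔ WindowPositive (d win) := by
  rw [← not_galerkinNegIndexAtLeast_one_iff_windowPositive, ← natCast_le_galerkinNegIndex_iff, Nat.cast_one,
    Order.one_le_iff_ne_zero, not_not]

/-- PROVED: the index number of `ζ`'s truncations is non-decreasing in `N` (nesting). [folklore] -/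
theorem zeta_galerkinNegIndex_mono {a : ℝ} {ha : 0 < a} {N N' : ℕ} (hNN' : N ≤ N') :
    galerkinNegIndex zetaDatum ⟨a, N, ha⟩ ≤ galerkinNegIndex zetaDatum ⟨a, N', ha⟩ :=
  iSup_mono fun _ ↦ iSup_mono' fun hn ↦ ⟨zeta_galerkinNegIndexAtLeast_mono hNN' hn, le_rfl⟩

/-! ## §2 `sup = #𝒬` -/

/-- **PROVED — UNCONDITIONAL: no truncated window matrix of `ζ` has more negative directions than there are
off-line zero quadruples**: `ind⁻(A^{(N)}(a)) ≤ 𝒬.encard` at every window. RH-free. [folklore] -/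
theorem galerkinNegIndex_le_encard (win : Window) :
    galerkinNegIndex zetaDatum win ≤
      {ρ : ℂ | ρ ∈ riemannZetaNontrivialZeros ∧ 1 / 2 < ρ.re ∧ 0 < ρ.im}.encard :=
  iSup_le fun _ ↦ iSup_le fun hn ↦ le_encard_quadrant_of_galerkinNegIndexAtLeast hn

/-- **PROVED — `⨆_{(a,N)} ind⁻(A^{(N)}(a)) = #𝒬`**: the supremum over all windows of the Galerkin negative index
of the truncated even block of `ζ` equals the number of off-line zero quadruples, in `ℕ ∪ {⊤}` (unconditional,
RH-free; GAL-3/GAL-4 + m2's `iSup_evenNegIndex_eq_encard`). [folklore] -/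
theorem iSup_galerkinNegIndex_eq_encard :
    (⨆ win : Window, galerkinNegIndex zetaDatum win) =
      {ρ : ℂ | ρ ∈ riemannZetaNontrivialZeros ∧ 1 / 2 < ρ.re ∧ 0 < ρ.im}.encard := by
  refine le_antisymm (iSup_le galerkinNegIndex_le_encard) ?_
  rw [← iSup_evenNegIndex_eq_encard]
  refine iSup_le fun a ↦ iSup_le fun n ↦ iSup_le fun hn ↦ ?_
  have hpos : 0 < max a 1 := lt_of_lt_of_le one_pos (le_max_right a 1)
  obtain ⟨N, hN⟩ := exists_galerkinNegIndexAtLeast_of_evenNegIndexAtLeast hpos (hn.mono (le_max_left a 1))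
  exact (le_galerkinNegIndex_of hN).trans (le_iSup (fun win ↦ galerkinNegIndex zetaDatum win) ⟨max a 1, N, hpos⟩)

/-- **PROVED — AT FIXED HALF-LENGTH: `⨆_N ind⁻(A^{(N)}(a)) = ind⁻_ev(a)`** (m2's continuum window index
`⨆ {n : EvenNegIndexAtLeast n a}`): the index law in numbers. RH-free. [folklore] -/
theorem iSup_galerkinNegIndex_eq_evenNegIndex {a : ℝ} (ha : 0 < a) :
    (⨆ N : ℕ, galerkinNegIndex zetaDatum ⟨a, N, ha⟩) = ⨆ n : ℕ, ⨆ _ : EvenNegIndexAtLeast n a, (n : ℕ∞) := by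
  refine le_antisymm (iSup_le fun N ↦ iSup_le fun n ↦ iSup_le fun hn ↦ ?_) (iSup_le fun n ↦ iSup_le fun hn ↦ ?_)
  · exact le_iSup_of_le (f := fun n : ℕ ↦ ⨆ _ : EvenNegIndexAtLeast n a, (n : ℕ∞)) n
      (le_iSup (fun _ : EvenNegIndexAtLeast n a ↦ (n : ℕ∞))
        (evenNegIndexAtLeast_of_galerkinNegIndexAtLeast hn))
  · obtain ⟨N, hN⟩ := exists_galerkinNegIndexAtLeast_of_evenNegIndexAtLeast ha hn
    exact (le_galerkinNegIndex_of hN).trans (le_iSup (fun N : ℕ ↦ galerkinNegIndex zetaDatum ⟨a, N, ha⟩) N)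

/-- PROVED: the index numbers of the truncations at `a` CONVERGE (monotonically in `N`) to `ind⁻_ev(a)`.
RH-free. [folklore] -/
theorem tendsto_galerkinNegIndex_atTop {a : ℝ} (ha : 0 < a) :
    Tendsto (fun N : ℕ ↦ galerkinNegIndex zetaDatum ⟨a, N, ha⟩) atTop
      (𝓝 (⨆ n : ℕ, ⨆ _ : EvenNegIndexAtLeast n a, (n : ℕ∞))) := by
  rw [← iSup_galerkinNegIndex_eq_evenNegIndex ha]
  exact tendsto_atTop_iSup fun N N' h ↦ zeta_galerkinNegIndex_mono h

/-- PROVED: `⨆_N ind⁻(A^{(N)}(a)) → #𝒬` as `a → ∞` (m2's `tendsto_evenNegIndex_atTop` through the index law).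
RH-free. [folklore] -/
theorem tendsto_iSup_galerkinNegIndex_atTop :
    Tendsto (fun a : ℝ ↦ ⨆ ha : 0 < a, ⨆ N : ℕ, galerkinNegIndex zetaDatum ⟨a, N, ha⟩) atTop
      (𝓝 {ρ : ℂ | ρ ∈ riemannZetaNontrivialZeros ∧ 1 / 2 < ρ.re ∧ 0 < ρ.im}.encard) := by
  refine tendsto_evenNegIndex_atTop.congr' ?_
  filter_upwards [eventually_gt_atTop 0] with a ha
  rw [iSup_pos ha, iSup_galerkinNegIndex_eq_evenNegIndex ha]

/-! ## §3 RH-equivalence readings (labels only; no RH claim) -/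

/-- RH-EQUIVALENCE (no RH claim): `RH ↔` every truncated window matrix of `ζ` has index number `0` (= the tree's
`AllWindowsPositive ζ ↔ RH`, read through `galerkinNegIndex_eq_zero_iff`). [folklore] -/
theorem riemannHypothesis_iff_forall_galerkinNegIndex_eq_zero :
    RiemannHypothesis ↔ ∀ win : Window, galerkinNegIndex zetaDatum win = 0 := by
  rw [riemannHypothesis_iff_quadrant_eq_empty, ← allWindowsPositive_zeta_iff_quadrant_eq_empty]
  unfold AllWindowsPositive
  exact forall_congr' fun win ↦ (galerkinNegIndex_eq_zero_iff _ win).symm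

/-- RH-EQUIVALENCE (no RH claim): `RH ↔ ⨆_{(a,N)} ind⁻(A^{(N)}(a)) = 0`. [folklore] -/
theorem riemannHypothesis_iff_iSup_galerkinNegIndex_eq_zero :
    RiemannHypothesis ↔ (⨆ win : Window, galerkinNegIndex zetaDatum win) = 0 := by
  rw [iSup_galerkinNegIndex_eq_encard, Set.encard_eq_zero, riemannHypothesis_iff_quadrant_eq_empty]

end Summit.RiemannHypothesis.RiemannHypothesis.Theorems.PfPersistence
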